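import Summits.KontsevichZagierPeriods.KontsevichZagierPeriods.Theorems.LinRedNormalFormArrangementNormalFormSeparateTwoAngular

/-!
# Local integrability of a weight with logarithmic contraction costs

(Line `janus-bands`, crux `ArrangementNormalForm`, stub `stub_separateTwoPos`, part `LocMass`.)
The FAR-POLE input of the numerator split at a point of the closed base piece: in blown-up
coordinates `(x, v)` on a thin sector, a measurable weight `W ≥ 0` which moves towards the
corner at logarithmic cost in each variable separately (radially: `separateTwo_radialLog`;
angularly: `separateTwo_cornerLog`, for the fibre mass times the Jacobian `x` and explicit
non-negative powers) and integrates ONE monomial `x^a v^b` is integrable itself: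
`∫⁻∫⁻ W < ∞` (`SepTwo.lintegral_lt_top_of_logmono₂`, registered as `separateTwo_locMass`).
Proof: the angular non-degeneracy lemma (`SepTwo.lintegral_le_pow_of_logmono`, part `Angular`)
in `v` at every abscissa, then in `x` for `g(x) = ∫⁻ W(x, v) dv`. Consequence: the fibre mass is
integrable near every point of the closed piece as soon as the representation converges (some
monomial of the non-zero numerator is integrable against it, part `MonoSplit`), so the Taylor
pieces at poles NOT passing through the point (bounded factors) converge — without any upper
bound theory for the fibre mass.
-/

noncomputable section

open Set MeasureTheory
open scoped ENNReal

namespace Summit.KontsevichZagierPeriods.ArrangementNormalForm.JanusBands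

namespace SepTwo

/-- **Local integrability from logarithmic contraction costs and one monomial.** -/
theorem lintegral_lt_top_of_logmono₂ (W : ℝ → ℝ → ℝ≥0∞) (hW : Measurable (Function.uncurry W))
    (K : ℕ) (C : ℝ≥0∞) (hC : C ≠ ∞) {δ ε : ℝ} (hδ : 0 < δ) (hε : 0 < ε)
    (hrad : ∀ v, 0 < v → v < ε → ∀ x x', 0 < x → x ≤ x' → x' < δ →
      W x v ≤ C * ENNReal.ofReal ((1 + Real.log (x' / x)) ^ K) * W x' v)
    (hang : ∀ x, 0 < x → x < δ → ∀ v v', 0 < v → v ≤ v' → v' < ε →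
      W x v ≤ C * ENNReal.ofReal ((1 + Real.log (v' / v)) ^ K) * W x v')
    (a b : ℕ)
    (hfin : ∫⁻ x in Ioo 0 δ, ∫⁻ v in Ioo 0 ε, ENNReal.ofReal (x ^ a * v ^ b) * W x v < ∞) :
    ∫⁻ x in Ioo 0 δ, ∫⁻ v in Ioo 0 ε, W x v < ∞ := by
  set A₀ : ℝ≥0∞ := C * ENNReal.ofReal (4 * (1 + 2 * K) ^ K) + 1 with hA₀
  have hA₀ne : A₀ ≠ ∞ := by
    rw [hA₀]; exact ENNReal.add_ne_top.2 ⟨ENNReal.mul_ne_top hC ENNReal.ofReal_ne_top, ENNReal.one_ne_top⟩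
  set g : ℝ → ℝ≥0∞ := fun x => ∫⁻ v in Ioo 0 ε, W x v with hg
  have hgm : Measurable g := hW.lintegral_prod_right'
  -- Step 1: angular non-degeneracy at every abscissa
  have h1 : ∀ x ∈ Ioo (0 : ℝ) δ, g x ≤ A₀ * ENNReal.ofReal ((2 / ε) ^ b) *
      ∫⁻ v in Ioo 0 ε, ENNReal.ofReal (v ^ b) * W x v := fun x hx =>
    lintegral_le_pow_of_logmono (W x) (Measurable.of_uncurry_left hW) K C hε
      (fun v v' hv hvv' hv' => hang x hx.1 hx.2 v v' hv hvv' hv') b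
  -- Step 2: the radial hypothesis for `g`
  have h2 : ∀ x x', 0 < x → x ≤ x' → x' < δ →
      g x ≤ C * ENNReal.ofReal ((1 + Real.log (x' / x)) ^ K) * g x' := by
    intro x x' hx hxx' hx'
    rw [hg]
    simp only
    rw [← lintegral_const_mul' _ _ (ENNReal.mul_ne_top hC ENNReal.ofReal_ne_top)]
    exact setLIntegral_mono' measurableSet_Ioo fun v hv => hrad v hv.1 hv.2 x x' hx hxx' hx'
  -- Step 3: angular non-degeneracy in the radial variable
  have h3 : ∫⁻ x in Ioo 0 δ, g x ≤ A₀ * ENNReal.ofReal ((2 / δ) ^ a) *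
      ∫⁻ x in Ioo 0 δ, ENNReal.ofReal (x ^ a) * g x :=
    lintegral_le_pow_of_logmono g hgm K C hδ h2 a
  -- Step 4: the monomial bound
  have h4 : ∫⁻ x in Ioo 0 δ, ENNReal.ofReal (x ^ a) * g x ≤ A₀ * ENNReal.ofReal ((2 / ε) ^ b) *
      ∫⁻ x in Ioo 0 δ, ∫⁻ v in Ioo 0 ε, ENNReal.ofReal (x ^ a * v ^ b) * W x v := by
    rw [← lintegral_const_mul' _ _ (ENNReal.mul_ne_top hA₀ne ENNReal.ofReal_ne_top)]
    refine setLIntegral_mono' measurableSet_Ioo fun x hx => ?_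
    have hm : Measurable fun v => ENNReal.ofReal (v ^ b) * W x v :=
      (ENNReal.measurable_ofReal.comp (measurable_id.pow_const b)).mul (Measurable.of_uncurry_left hW)
    calc ENNReal.ofReal (x ^ a) * g x
        ≤ ENNReal.ofReal (x ^ a) * (A₀ * ENNReal.ofReal ((2 / ε) ^ b) *
            ∫⁻ v in Ioo 0 ε, ENNReal.ofReal (v ^ b) * W x v) := mul_le_mul_right (h1 x hx) _
      _ = A₀ * ENNReal.ofReal ((2 / ε) ^ b) *
            (ENNReal.ofReal (x ^ a) * ∫⁻ v in Ioo 0 ε, ENNReal.ofReal (v ^ b) * W x v) := by ring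
      _ = A₀ * ENNReal.ofReal ((2 / ε) ^ b) *
            ∫⁻ v in Ioo 0 ε, ENNReal.ofReal (x ^ a * v ^ b) * W x v := by
          rw [← lintegral_const_mul _ hm]
          congr 1
          refine lintegral_congr fun v => ?_
          rw [ENNReal.ofReal_mul (pow_nonneg hx.1.le a), mul_assoc]
  calc ∫⁻ x in Ioo 0 δ, ∫⁻ v in Ioo 0 ε, W x v = ∫⁻ x in Ioo 0 δ, g x := rfl
    _ ≤ A₀ * ENNReal.ofReal ((2 / δ) ^ a) * ∫⁻ x in Ioo 0 δ, ENNReal.ofReal (x ^ a) * g x := h3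
    _ ≤ A₀ * ENNReal.ofReal ((2 / δ) ^ a) * (A₀ * ENNReal.ofReal ((2 / ε) ^ b) *
        ∫⁻ x in Ioo 0 δ, ∫⁻ v in Ioo 0 ε, ENNReal.ofReal (x ^ a * v ^ b) * W x v) :=
        mul_le_mul_right h4 _
    _ < ∞ := ENNReal.mul_lt_top (ENNReal.mul_lt_top hA₀ne.lt_top ENNReal.ofReal_lt_top)
        (ENNReal.mul_lt_top (ENNReal.mul_lt_top hA₀ne.lt_top ENNReal.ofReal_lt_top) hfin)

end SepTwo

/-- **Local integrability of a weight with logarithmic contraction costs** (registered part of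
`stub_separateTwoPos`; literal form of `SepTwo.lintegral_lt_top_of_logmono₂`): a measurable
weight on `(0, δ) × (0, ε)` with logarithmic contraction costs in each variable which integrates
one monomial `x^a v^b` is integrable. -/
theorem separateTwo_locMass (W : ℝ → ℝ → ENNReal) (hW : Measurable (Function.uncurry W)) (K : ℕ) (C : ENNReal) (hC : C ≠ ⊤) (δ ε : ℝ) (hδ : 0 < δ) (hε : 0 < ε) (hrad : ∀ v : ℝ, 0 < v → v < ε → ∀ x x' : ℝ, 0 < x → x ≤ x' → x' < δ → W x v ≤ C * ENNReal.ofReal ((1 + Real.log (x' / x)) ^ K) * W x' v) (hang : ∀ x : ℝ, 0 < x → x < δ → ∀ v v' : ℝ, 0 < v → v ≤ v' → v' < ε → W x v ≤ C * ENNReal.ofReal ((1 + Real.log (v' / v)) ^ K) * W x v') (a b : ℕ) (hfin : MeasureTheory.lintegral (MeasureTheory.volume.restrict (Set.Ioo 0 δ)) (fun x => MeasureTheory.lintegral (MeasureTheory.volume.restrict (Set.Ioo 0 ε)) (fun v => ENNReal.ofReal (x ^ a * v ^ b) * W x v)) < ⊤) : MeasureTheory.lintegral (MeasureTheory.volume.restrict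 (Set.Ioo 0 δ)) (fun x => MeasureTheory.lintegral (MeasureTheory.volume.restrict (Set.Ioo 0 ε)) (fun v => W x v)) < ⊤ := by
  exact SepTwo.lintegral_lt_top_of_logmono₂ W hW K C hC hδ hε hrad hang a b hfin

end Summit.KontsevichZagierPeriods.ArrangementNormalForm.JanusBands
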